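import Literature.NumberTheory.LFunctions.ClassGroupDegreeOneTheta
import Literature.NumberTheory.LFunctions.UniformClassGroupPNTChebyshev
import HarnessLib

/-!
# `ψ_C` versus `θ_C` for an ideal class, uniformly in the field (the prime-ideal-power step of
# Thorner–Zaman's Lemma 2.1)

Topic `Literature/NumberTheory/LFunctions` (namespace `Literature.NumberTheory.LFunctions.NumberField`).
Everything here is PROVED (theorems only; no definition, no named fact).

For a number field `K`, a class `C ∈ Cl(K)` and `x ≥ 0` the tree has two Chebyshev functions of
the class: `θ_C(x) = Σ_{N𝔭 ≤ x, [𝔭] = C} log N𝔭` (`chebyshevThetaIdealClass`,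
`UniformClassGroupPNTChebyshev.lean`) and, through the von Mangoldt function of the class
`Λ_C(n) = h_K Σ_{N𝔞 = n, [𝔞] = C} Λ(𝔞)` (`classVonMangoldt`, `ClassGroupPsiErrorTerm.lean`), the
sum `Σ_{n ≤ x} Λ_C(n) = h_K ψ_C(x)`, `ψ_C(x) = Σ_{N𝔞 ≤ x, [𝔞] = C} Λ(𝔞)` — Thorner–Zaman's
`ψ_C(x, H_K/K)` ((2.2) with `|C| = 1`, `𝟙_C(𝔭^j) = [[𝔭]^j = C]`).  We prove the step
"`|θ_C(x) − ψ_C(x)| ≪ n_F x^{1/2}` by trivially estimating the number of prime ideal powers with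
norm at most `x`" of the proof of [ThornerZaman2019, Lemma 2.1], in the field-uniform form

  `h_K θ_C(x) ≤ Σ_{n ≤ x} Λ_C(n) ≤ h_K (θ_C(x) + π_K(√x) log x)`   (`x ≥ 1`)

(`card_mul_chebyshevThetaIdealClass_le_sum_classVonMangoldt`,
`sum_classVonMangoldt_le_card_mul`): the ideals `𝔞` with `Λ(𝔞) ≠ 0` that are not prime are the
`𝔭^m`, `m ≥ 2`, so `N𝔭 ≤ √x`, and for each such `𝔭` there are at most `log x/log N𝔭` of them, each
weighing `log N𝔭` (`sum_sdiff_idealVonMangoldt_le`).  With `π_K(√x) ≤ [K:ℚ] √x` this is the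
printed `≪ n_F x^{1/2} log x`-type bound; it converts `ψ_C`-form prime number theorems for classes
(the explicit-formula side, `ClassGroupPsiErrorTerm.lean`) into the `θ_C`-form consumed by the
reductions `ThornerZaman2019_classPNT_imaginaryQuadratic_of_thetaForm` /
`ThornerZaman2019_classPNT_hilbertClassField_of_thetaForm`.

Also: `sum_Icc_classVonMangoldt_eq` (`Σ_{n ≤ x} Λ_C(n) = h_K Σ_{N𝔞 ≤ x, [𝔞] = C} Λ(𝔞)`),
`idealInClass_iff_exists_mk0` (the two spellings of `[𝔞] = C` in the tree agree).

## References

* J. Thorner, A. Zaman, *A unified and improved Chebotarev density theorem*, Algebra Number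
  Theory 13 (2019) 1039–1068, §2.1, Lemma 2.1 (proof). [ThornerZaman2019]
* E. Landau, Math. Ann. 56 (1903), §12 p. 669 (`Σ_{N𝔭^ν ≤ x, ν ≥ 2} log N𝔭`). [LandauMathAnn1903]
-/

noncomputable section

open scoped NumberField nonZeroDivisors
open Finset Real NumberField UniqueFactorizationMonoid

namespace Literature.NumberTheory.LFunctions.NumberField

variable {K : Type*} [Field K] [NumberField K]

/-- The two spellings of "`[𝔞] = C`" in the tree (`IdealInClass`, via `𝔞 ≠ ⊥`, and the
`∃ h𝔞 : 𝔞 ∈ (Ideal (𝓞 K))⁰, mk0 ⟨𝔞, h𝔞⟩ = C` of `primeIdealsInClassLE`) agree. [folklore] -/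
theorem idealInClass_iff_exists_mk0 (C : ClassGroup (𝓞 K)) (I : Ideal (𝓞 K)) :
    IdealInClass K C I ↔ ∃ hI : I ∈ (Ideal (𝓞 K))⁰, ClassGroup.mk0 ⟨I, hI⟩ = C := by
  constructor
  · rintro ⟨h, hC⟩
    exact ⟨mem_nonZeroDivisors_of_ne_zero h, hC⟩
  · rintro ⟨h, hC⟩
    exact ⟨nonZeroDivisors.ne_zero h, hC⟩

open scoped Classical in
/-- **`Σ_{n ≤ x} Λ_C(n) = h_K Σ_{N𝔞 ≤ x, [𝔞] = C} Λ(𝔞)`** (regrouping by the norm). [folklore] -/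
theorem sum_Icc_classVonMangoldt_eq (C : ClassGroup (𝓞 K)) (x : ℝ) :
    ∑ n ∈ Icc 0 ⌊x⌋₊, classVonMangoldt K C n =
      (Fintype.card (ClassGroup (𝓞 K)) : ℝ) *
        ∑ I ∈ ((Ideal.finite_setOf_absNorm_le (S := 𝓞 K) ⌊x⌋₊).toFinset).filter
            (fun I ↦ IdealInClass K C I), idealVonMangoldt I := by
  classical
  simp_rw [classVonMangoldt_eq_sum_filter, ← mul_sum]
  congr 1
  set T : Finset (Ideal (𝓞 K)) :=
    ((Ideal.finite_setOf_absNorm_le (S := 𝓞 K) ⌊x⌋₊).toFinset).filter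
      (fun I ↦ IdealInClass K C I) with hT
  have hmaps : ∀ I ∈ T, Ideal.absNorm I ∈ Icc 0 ⌊x⌋₊ := by
    intro I hI
    rw [hT, mem_filter, Set.Finite.mem_toFinset, Set.mem_setOf_eq] at hI
    exact mem_Icc.mpr ⟨Nat.zero_le _, hI.1⟩
  calc ∑ n ∈ Icc 0 ⌊x⌋₊, ∑ I ∈ (idealsOfNorm K n).filter (fun I ↦ IdealInClass K C I),
          idealVonMangoldt I
      = ∑ n ∈ Icc 0 ⌊x⌋₊, ∑ I ∈ T with Ideal.absNorm I = n, idealVonMangoldt I := by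
        refine sum_congr rfl fun n hn ↦ sum_congr ?_ fun _ _ ↦ rfl
        ext I
        simp only [hT, mem_filter, Set.Finite.mem_toFinset, Set.mem_setOf_eq, mem_idealsOfNorm]
        constructor
        · rintro ⟨hn', hC⟩
          exact ⟨⟨hn' ▸ (mem_Icc.mp hn).2, hC⟩, hn'⟩
        · rintro ⟨⟨-, hC⟩, hn'⟩
          exact ⟨hn', hC⟩
    _ = ∑ I ∈ T, idealVonMangoldt I := sum_fiberwise_of_maps_to hmaps _

open scoped Classical in
/-- The primes of norm `≤ x` in the class `C` are among the ideals of norm `≤ ⌊x⌋` in `C`.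
[folklore] -/
theorem primeIdealsInClassLE_toFinset_subset (C : ClassGroup (𝓞 K)) (x : ℝ) :
    (finite_primeIdealsInClassLE C x).toFinset ⊆
      ((Ideal.finite_setOf_absNorm_le (S := 𝓞 K) ⌊x⌋₊).toFinset).filter
        (fun I ↦ IdealInClass K C I) := by
  classical
  intro P hP
  rw [Set.Finite.mem_toFinset, primeIdealsInClassLE, Set.mem_setOf_eq] at hP
  obtain ⟨-, hx, hC⟩ := hP
  rw [mem_filter, Set.Finite.mem_toFinset, Set.mem_setOf_eq]
  exact ⟨Nat.le_floor hx, (idealInClass_iff_exists_mk0 C P).mpr hC⟩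

/-- On the primes of the class, `Λ(𝔭) = log N𝔭`. [folklore] -/
theorem idealVonMangoldt_of_mem_primeIdealsInClassLE (C : ClassGroup (𝓞 K)) {x : ℝ}
    {P : Ideal (𝓞 K)} (hP : P ∈ (finite_primeIdealsInClassLE C x).toFinset) :
    idealVonMangoldt P = Real.log (Ideal.absNorm P) := by
  rw [Set.Finite.mem_toFinset, primeIdealsInClassLE, Set.mem_setOf_eq] at hP
  obtain ⟨hprime, -, h0, -⟩ := hP
  have hPr : Prime P := Ideal.prime_of_isPrime (nonZeroDivisors.ne_zero h0) hprime
  have := idealVonMangoldt_prime_pow hPr one_ne_zero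
  rwa [pow_one] at this

/-- **`h_K θ_C(x) ≤ Σ_{n ≤ x} Λ_C(n)`** (`Λ ≥ 0`, and `Λ(𝔭) = log N𝔭` on the primes of the class).
[cite: ThornerZaman2019, §2.1 Lemma 2.1 (proof)] -/
theorem card_mul_chebyshevThetaIdealClass_le_sum_classVonMangoldt (C : ClassGroup (𝓞 K)) {x : ℝ}
    (hx : 0 ≤ x) :
    (Fintype.card (ClassGroup (𝓞 K)) : ℝ) * chebyshevThetaIdealClass K C x ≤
      ∑ n ∈ Icc 0 ⌊x⌋₊, classVonMangoldt K C n := by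
  classical
  rw [sum_Icc_classVonMangoldt_eq, chebyshevThetaIdealClass_eq_sum_primeIdealsInClassLE K C hx]
  refine mul_le_mul_of_nonneg_left ?_ (Nat.cast_nonneg _)
  calc ∑ P ∈ (finite_primeIdealsInClassLE C x).toFinset, Real.log (Ideal.absNorm P : ℝ)
      = ∑ P ∈ (finite_primeIdealsInClassLE C x).toFinset, idealVonMangoldt P :=
        sum_congr rfl fun P hP ↦ (idealVonMangoldt_of_mem_primeIdealsInClassLE C hP).symm
    _ ≤ _ := sum_le_sum_of_subset_of_nonneg (primeIdealsInClassLE_toFinset_subset C x)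
        fun I _ _ ↦ idealVonMangoldt_nonneg I

open scoped Classical in
/-- **The prime ideal powers are negligible**: the ideals `𝔞` of the class with `N𝔞 ≤ x` that
are not prime contribute at most `π_K(√x) log x` to `Σ Λ(𝔞)` (those with `Λ(𝔞) ≠ 0` are the
`𝔭^m`, `m ≥ 2`, `N𝔭 ≤ √x`; for each `𝔭` at most `log x/log N𝔭` exponents, each weighing
`log N𝔭`). [cite: ThornerZaman2019, §2.1 Lemma 2.1 (proof)] -/
theorem sum_sdiff_idealVonMangoldt_le (C : ClassGroup (𝓞 K)) {x : ℝ} (hx : 1 ≤ x) :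
    ∑ I ∈ (((Ideal.finite_setOf_absNorm_le (S := 𝓞 K) ⌊x⌋₊).toFinset).filter
        (fun I ↦ IdealInClass K C I)) \ (finite_primeIdealsInClassLE C x).toFinset,
        idealVonMangoldt I ≤ primeIdealCount K (Real.sqrt x) * Real.log x := by
  classical
  have hx0 : 0 ≤ x := by linarith
  have hlx : 0 ≤ Real.log x := Real.log_nonneg hx
  set T : Finset (Ideal (𝓞 K)) :=
    ((Ideal.finite_setOf_absNorm_le (S := 𝓞 K) ⌊x⌋₊).toFinset).filter
      (fun I ↦ IdealInClass K C I) with hT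
  set PC : Finset (Ideal (𝓞 K)) := (finite_primeIdealsInClassLE C x).toFinset with hPC
  set Pr : Finset (Ideal (𝓞 K)) := (finite_primeIdealsLE K (Real.sqrt x)).toFinset with hPr
  -- the unique prime factor of an ideal with `Λ ≠ 0`
  set rad : Ideal (𝓞 K) → Ideal (𝓞 K) := fun I ↦
    if h : (normalizedFactors I).toFinset.card = 1 then (eq_prime_pow_of_card_eq_one h).choose
    else ⊥ with hrad
  -- structure of the ideals of `T \ PC` with `Λ ≠ 0`
  have key : ∀ I ∈ (T \ PC).filter (fun I ↦ idealVonMangoldt I ≠ 0),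
      Prime (rad I) ∧ 2 ≤ Multiset.card (normalizedFactors I) ∧
        I = rad I ^ Multiset.card (normalizedFactors I) ∧
        ((Ideal.absNorm (rad I) : ℝ)) ^ Multiset.card (normalizedFactors I) ≤ x := by
    intro I hI
    rw [mem_filter, mem_sdiff] at hI
    obtain ⟨⟨hIT, hIPC⟩, hΛ⟩ := hI
    have hcard : (normalizedFactors I).toFinset.card = 1 := by
      by_contra hne; exact hΛ (idealVonMangoldt_eq_zero hne)
    have hradI : rad I = (eq_prime_pow_of_card_eq_one hcard).choose := by
      simp only [hrad, dif_pos hcard]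
    obtain ⟨hPp, -, -, hmpos, hIeq⟩ := (eq_prime_pow_of_card_eq_one hcard).choose_spec
    rw [← hradI] at hPp hIeq
    set m := Multiset.card (normalizedFactors I) with hm
    rw [hT, mem_filter, Set.Finite.mem_toFinset, Set.mem_setOf_eq] at hIT
    obtain ⟨hIN, hIC⟩ := hIT
    have hIx : (Ideal.absNorm I : ℝ) ≤ x :=
      le_trans (by exact_mod_cast hIN) (Nat.floor_le hx0)
    have hpow : ((Ideal.absNorm (rad I) : ℝ)) ^ m ≤ x := by
      have : Ideal.absNorm I = Ideal.absNorm (rad I) ^ m := by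
        conv_lhs => rw [hIeq]
        rw [map_pow]
      rw [this] at hIx
      exact_mod_cast hIx
    -- `m ≠ 1`: otherwise `I = rad I` is a prime of the class of norm `≤ x`, i.e. `I ∈ PC`
    have hm1 : m ≠ 1 := by
      intro h1
      apply hIPC
      have hI1 : I = rad I := by rw [h1, pow_one] at hIeq; exact hIeq
      rw [hPC, Set.Finite.mem_toFinset, primeIdealsInClassLE, Set.mem_setOf_eq]
      refine ⟨?_, hIx, (idealInClass_iff_exists_mk0 C I).mp hIC⟩
      rw [hI1]
      exact Ideal.isPrime_of_prime hPp
    exact ⟨hPp, by omega, hIeq, hpow⟩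
  -- `rad` maps these ideals to the primes of norm `≤ √x`
  have hmaps : ∀ I ∈ (T \ PC).filter (fun I ↦ idealVonMangoldt I ≠ 0), rad I ∈ Pr := by
    intro I hI
    obtain ⟨hPp, h2, -, hpow⟩ := key I hI
    rw [hPr, Set.Finite.mem_toFinset, primeIdealsLE, Set.mem_setOf_eq]
    refine ⟨Ideal.isPrime_of_prime hPp, hPp.ne_zero, ?_⟩
    have h1 : (1 : ℝ) ≤ Ideal.absNorm (rad I) := by
      have : Ideal.absNorm (rad I) ≠ 0 := by
        rw [Ne, Ideal.absNorm_eq_zero_iff]; exact hPp.ne_zero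
      exact_mod_cast Nat.one_le_iff_ne_zero.mpr this
    have hsq : ((Ideal.absNorm (rad I) : ℝ)) ^ 2 ≤ x :=
      (pow_le_pow_right₀ h1 h2).trans hpow
    calc (Ideal.absNorm (rad I) : ℝ) = Real.sqrt (((Ideal.absNorm (rad I) : ℝ)) ^ 2) :=
          (Real.sqrt_sq (by positivity)).symm
      _ ≤ Real.sqrt x := Real.sqrt_le_sqrt hsq
  -- each fibre weighs at most `log x`
  have hfib : ∀ P ∈ Pr,
      ∑ I ∈ ((T \ PC).filter (fun I ↦ idealVonMangoldt I ≠ 0)) with rad I = P,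
        idealVonMangoldt I ≤ Real.log x := by
    intro P hP
    rw [hPr, Set.Finite.mem_toFinset, primeIdealsLE, Set.mem_setOf_eq] at hP
    obtain ⟨hPprime, hP0, -⟩ := hP
    have hP2 : 2 ≤ Ideal.absNorm P := two_le_absNorm_of_isPrime hPprime hP0
    have hlogP : 0 < Real.log (Ideal.absNorm P : ℝ) := Real.log_pos (by exact_mod_cast hP2)
    set F : Finset (Ideal (𝓞 K)) :=
      ((T \ PC).filter (fun I ↦ idealVonMangoldt I ≠ 0)).filter (fun I ↦ rad I = P) with hF
    set M : ℕ := ⌊Real.log x / Real.log (Ideal.absNorm P : ℝ)⌋₊ with hM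
    -- on the fibre `Λ = log N P`, and the fibre lies in `{P^m : 2 ≤ m ≤ M}`
    have hval : ∀ I ∈ F, idealVonMangoldt I = Real.log (Ideal.absNorm P : ℝ) := by
      intro I hI
      rw [hF, mem_filter] at hI
      obtain ⟨hI, hIP⟩ := hI
      obtain ⟨hPp, h2, hIeq, -⟩ := key I hI
      rw [hIP] at hPp hIeq
      rw [hIeq, idealVonMangoldt_prime_pow hPp (by omega)]
    have hsub : F ⊆ (Icc 2 M).image (fun m ↦ P ^ m) := by
      intro I hI
      rw [hF, mem_filter] at hI
      obtain ⟨hI, hIP⟩ := hI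
      obtain ⟨hPp, h2, hIeq, hpow⟩ := key I hI
      rw [hIP] at hIeq hpow
      refine mem_image.mpr ⟨Multiset.card (normalizedFactors I), mem_Icc.mpr ⟨h2, ?_⟩, hIeq.symm⟩
      refine Nat.le_floor ?_
      rw [le_div_iff₀ hlogP, ← Real.log_pow]
      exact Real.log_le_log (by positivity) hpow
    have hcard : (F.card : ℝ) ≤ M := by
      have h1 : F.card ≤ (Icc 2 M).card := (card_le_card hsub).trans card_image_le
      rw [Nat.card_Icc] at h1
      exact_mod_cast h1.trans (by omega)
    have hMle : (M : ℝ) * Real.log (Ideal.absNorm P : ℝ) ≤ Real.log x := by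
      have := Nat.floor_le (div_nonneg hlx hlogP.le)
      rw [← hM] at this
      calc (M : ℝ) * Real.log (Ideal.absNorm P : ℝ)
          ≤ Real.log x / Real.log (Ideal.absNorm P : ℝ) * Real.log (Ideal.absNorm P : ℝ) :=
            mul_le_mul_of_nonneg_right this hlogP.le
        _ = Real.log x := div_mul_cancel₀ _ hlogP.ne'
    calc ∑ I ∈ F, idealVonMangoldt I = ∑ I ∈ F, Real.log (Ideal.absNorm P : ℝ) :=
          sum_congr rfl hval
      _ = F.card * Real.log (Ideal.absNorm P : ℝ) := by rw [sum_const, nsmul_eq_mul]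
      _ ≤ M * Real.log (Ideal.absNorm P : ℝ) := mul_le_mul_of_nonneg_right hcard hlogP.le
      _ ≤ Real.log x := hMle
  -- assemble
  have hπ : (primeIdealCount K (Real.sqrt x) : ℝ) = Pr.card := by
    rw [primeIdealCount, hPr, Set.ncard_eq_toFinset_card _ (finite_primeIdealsLE K (Real.sqrt x))]
  calc ∑ I ∈ T \ PC, idealVonMangoldt I
      = ∑ I ∈ (T \ PC).filter (fun I ↦ idealVonMangoldt I ≠ 0), idealVonMangoldt I :=
        (sum_filter_ne_zero _).symm
    _ = ∑ P ∈ Pr, ∑ I ∈ ((T \ PC).filter (fun I ↦ idealVonMangoldt I ≠ 0)) with rad I = P,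
          idealVonMangoldt I := (sum_fiberwise_of_maps_to hmaps _).symm
    _ ≤ ∑ P ∈ Pr, Real.log x := sum_le_sum hfib
    _ = primeIdealCount K (Real.sqrt x) * Real.log x := by rw [sum_const, nsmul_eq_mul, hπ]

/-- **`Σ_{n ≤ x} Λ_C(n) ≤ h_K (θ_C(x) + π_K(√x) log x)`** for `x ≥ 1`: the `ψ`-to-`θ` step of
[ThornerZaman2019, Lemma 2.1] for a class of the Hilbert class field, uniformly in the field.
[cite: ThornerZaman2019, §2.1 Lemma 2.1 (proof)] -/
theorem sum_classVonMangoldt_le_card_mul (C : ClassGroup (𝓞 K)) {x : ℝ} (hx : 1 ≤ x) :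
    ∑ n ∈ Icc 0 ⌊x⌋₊, classVonMangoldt K C n ≤
      (Fintype.card (ClassGroup (𝓞 K)) : ℝ) *
        (chebyshevThetaIdealClass K C x + primeIdealCount K (Real.sqrt x) * Real.log x) := by
  classical
  have hx0 : 0 ≤ x := by linarith
  rw [sum_Icc_classVonMangoldt_eq, chebyshevThetaIdealClass_eq_sum_primeIdealsInClassLE K C hx0]
  refine mul_le_mul_of_nonneg_left ?_ (Nat.cast_nonneg _)
  rw [← sum_sdiff (primeIdealsInClassLE_toFinset_subset C x), add_comm]
  refine add_le_add (le_of_eq (sum_congr rfl fun P hP ↦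
    idealVonMangoldt_of_mem_primeIdealsInClassLE C hP)) (sum_sdiff_idealVonMangoldt_le C hx)

/-- **`|Σ_{n ≤ x} Λ_C(n) − h_K θ_C(x)| ≤ h_K π_K(√x) log x`** for `x ≥ 1` (the two previous bounds
combined). [cite: ThornerZaman2019, §2.1 Lemma 2.1 (proof)] -/
theorem abs_sum_classVonMangoldt_sub_card_mul_theta_le (C : ClassGroup (𝓞 K)) {x : ℝ}
    (hx : 1 ≤ x) :
    |∑ n ∈ Icc 0 ⌊x⌋₊, classVonMangoldt K C n -
        (Fintype.card (ClassGroup (𝓞 K)) : ℝ) * chebyshevThetaIdealClass K C x| ≤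
      (Fintype.card (ClassGroup (𝓞 K)) : ℝ) * (primeIdealCount K (Real.sqrt x) * Real.log x) := by
  have h1 := card_mul_chebyshevThetaIdealClass_le_sum_classVonMangoldt C (x := x) (by linarith)
  have h2 := sum_classVonMangoldt_le_card_mul C hx
  rw [abs_le]
  constructor
  · have : 0 ≤ (Fintype.card (ClassGroup (𝓞 K)) : ℝ) *
        (primeIdealCount K (Real.sqrt x) * Real.log x) :=
      mul_nonneg (Nat.cast_nonneg _) (mul_nonneg (Nat.cast_nonneg _) (Real.log_nonneg hx))
    linarith
  · linarith [mul_add (Fintype.card (ClassGroup (𝓞 K)) : ℝ) (chebyshevThetaIdealClass K C x)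
      (primeIdealCount K (Real.sqrt x) * Real.log x)]

end Literature.NumberTheory.LFunctions.NumberField

end
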